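import Summits.CriticalPhenomena.PercolationContinuityZ3.Theorems.PercNearOneGluingAdditiveGluingMultiEdgeLemma3
import HarnessLib

/-! # Crux `PercNearOneGluing.AdditiveGluing` (stmt-CriticalPhenomena-4576) — the HYBRID CERTIFICATE lemma (strategy (b))

Support file (`--supports stmt-CriticalPhenomena-4576`); no definitions, no named facts.  Companion of
`…AdditiveGluingMultiEdgeLemma3.lean` (multi-edge Lemma 3, `multiEdge_core`).

`μ_w = prodBernoulli w` on the bond configurations of `Fin n`, target `b`, `τ(v) = μ(v ↔ b)`.  For a vertex `x ∉ T`, the star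
`F = {s(x,a) : a ∈ T}`, `R = {some edge of F open}` and the weighting `w⁰ = pinW w F ∅` (star deleted):

**Theorem (`hybridCertificate`).**  If `c` is `w⁰`-minimal among `{d} ∪ T` then `μ(c ↔ b) ≤ μ(R ∩ {x ↔ b}) + μ(Rᶜ ∩ {d ↔ b})`.

This is exactly the SHAPE of the closed form of the official line's residual certificate (lead c5, LeadMath-c5 §H1 (★) / §J2:
`CERT(x', a') ⇔ τ_{u/S}(a₀) ≤ μ_u(R₁ ∩ {S ↔ b}) + μ_u(R₁ᶜ ∩ {a' ↔_{u/S} b})`): with `x = ` the glued block `S`, `F` = the `x'–A` edges,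
`c = a₀`, `d = a'`, CERT(x', a') holds whenever `a₀` is minimal among `{a'} ∪ N_A(x')` in the weighting `(u/S) − (x'–A edges)`
(seat-b numerics lab/cert_scan.py: 292/300 random blocks, but only 2/10 ALL-DRIFT blocks — the all-drift class remains the content).
Proof: `μ(c b) = μ(R, c b) + μ(Rᶜ, c b)`; pattern-wise `multiEdge_core` gives `μ(R, c b) ≤ μ(R, x b)`; and
`μ(Rᶜ, c b) = μ([∅]_F) τ⁰(c) ≤ μ([∅]_F) τ⁰(d) = μ(Rᶜ, d b)`.
[cite: KozmaNitzan2024, Lemma 5 (p. 13), Lemma 3(i) (pp. 6–7), §3.2 pp. 12–14]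
-/

namespace Summit.CriticalPhenomena.PercolationContinuityZ3.Theorems

open MeasureTheory Set
open Literature.Probability.LatticeModels (prodBernoulli)
open Literature.Probability.Percolation (BondConfig openConn openGraph openEdgeCluster pinW localCylinder
  DeterminedBy determinedBy_iff)

noncomputable section
open Classical

section HybridCertificate

open Literature.Probability.LatticeModels Literature.Probability.Percolation

variable {n : ℕ}

/-- **Hybrid certificate lemma (HCL)** — the shape of the lead's closed-form bystander certificate (LeadMath-c5 §H1 (★),
`τ_{u/S}(a₀) ≤ μ(R₁ ∩ {S ↔ b}) + μ(R₁ᶜ ∩ {a' ↔' b})`).  Let `x ∉ T`, `F` = the star `x–T`, `R = {some edge of F open}` and `w⁰`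
the weighting with `F` deleted (`pinW w F ∅`).  If `c` is `w⁰`-minimal among `{d} ∪ T`
(`τ⁰(c) ≤ τ⁰(a)` for `a ∈ T` and `τ⁰(c) ≤ τ⁰(d)`), then
`μ_w(c ↔ b) ≤ μ_w(R ∩ {x ↔ b}) + μ_w(Rᶜ ∩ {d ↔ b})`: the reliability of `c` is at most that of the HYBRID "x on its relay-contact
event, `d` off it".  Proof: `μ(c b) = μ(R, c b) + μ(Rᶜ, c b)`; the first is `≤ μ(R, x b)` pattern-wise by `multiEdge_core` (star gluing form of
Lemma 5), the second is `μ([∅]_F)·τ⁰(c) ≤ μ([∅]_F)·τ⁰(d) = μ(Rᶜ, d b)`.  With `x = [S]` (a glued block), `F` = the `x'–A` edges, `c = a₀`,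
`d = a'` this is CERT(x', a') of the v8 residual `stub_bystanderCert_c5` whenever `a₀` is minimal among `{a'} ∪ N_A(x')` in
`(u/S) − (x'–A edges)` (numerically: 292/300 random blocks, 2/10 all-drift blocks — lab/cert_scan.py of seat b).
[cite: KozmaNitzan2024, Lemma 5 (p. 13), Lemma 3(i) (pp. 6–7)] -/
theorem hybridCertificate (w : Sym2 (Fin n) → unitInterval) (x c d b : Fin n) (T : Finset (Fin n)) (hxT : x ∉ T)
    (hcT : ∀ a ∈ T,
      (prodBernoulli (pinW w (↑(T.image fun a => s(x, a)) : Set (Sym2 (Fin n))) ↑(∅ : Finset (Sym2 (Fin n))))).real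
          (openConn c b) ≤
        (prodBernoulli (pinW w (↑(T.image fun a => s(x, a)) : Set (Sym2 (Fin n))) ↑(∅ : Finset (Sym2 (Fin n))))).real
          (openConn a b))
    (hcd : (prodBernoulli (pinW w (↑(T.image fun a => s(x, a)) : Set (Sym2 (Fin n))) ↑(∅ : Finset (Sym2 (Fin n))))).real
          (openConn c b) ≤
        (prodBernoulli (pinW w (↑(T.image fun a => s(x, a)) : Set (Sym2 (Fin n))) ↑(∅ : Finset (Sym2 (Fin n))))).real
          (openConn d b)) :
    (prodBernoulli w).real (openConn c b) ≤
      (prodBernoulli w).real ({ω : Set (Sym2 (Fin n)) | ∃ a ∈ T, s(x, a) ∈ ω} ∩ openConn x b) +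
        (prodBernoulli w).real ({ω : Set (Sym2 (Fin n)) | ∃ a ∈ T, s(x, a) ∈ ω}ᶜ ∩ openConn d b) := by
  set F : Finset (Sym2 (Fin n)) := T.image (fun a => s(x, a)) with hFdef
  have hF : ∀ e ∈ F, ∃ a, a ≠ x ∧ e = s(x, a) := by
    intro e he
    obtain ⟨a, haT, rfl⟩ := Finset.mem_image.1 he
    exact ⟨a, fun h => hxT (h ▸ haT), rfl⟩
  have hR : {ω : Set (Sym2 (Fin n)) | ∃ a ∈ T, s(x, a) ∈ ω} = {ω | ∃ e ∈ F, e ∈ ω} := by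
    ext ω
    simp only [Set.mem_setOf_eq, hFdef, Finset.mem_image]
    constructor
    · rintro ⟨a, haT, ha⟩; exact ⟨s(x, a), ⟨a, haT, rfl⟩, ha⟩
    · rintro ⟨e, ⟨a, haT, rfl⟩, he⟩; exact ⟨a, haT, he⟩
  rw [hR]
  set R : Set (Set (Sym2 (Fin n))) := {ω | ∃ e ∈ F, e ∈ ω} with hRdef
  set w₀ : Sym2 (Fin n) → unitInterval := pinW w ↑F ↑(∅ : Finset (Sym2 (Fin n))) with hw₀
  -- CORE on every pattern meeting `R`
  have hcore : ∀ J : Finset (Sym2 (Fin n)), J ⊆ F → (↑J : Set (Sym2 (Fin n))) ∈ R →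
      (prodBernoulli (pinW w ↑F ↑J)).real (openConn c b) ≤
        (prodBernoulli (pinW w ↑F ↑J)).real (openConn x b) := by
    intro J hJF hJR
    obtain ⟨e, heF, heJ⟩ := hJR
    have heJ' : e ∈ J := Finset.mem_coe.1 heJ
    obtain ⟨a, hax, rfl⟩ := hF e heF
    have haT : a ∈ T := by
      obtain ⟨a', ha'T, he'⟩ := Finset.mem_image.1 heF
      rcases Sym2.eq_iff.1 he' with ⟨-, h⟩ | ⟨h, -⟩
      · exact h ▸ ha'T
      · exact (hax h.symm).elim
    exact multiEdge_core w hF hJF heJ' hax c b (hcT a haT)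
  have hRm : MeasurableSet R := MeasurableSet.of_discrete
  have hdec := fun v : Fin n =>
    prodBernoulli_real_inter_eq_sum_pinW w F (A := openConn v b) (B := R) MeasurableSet.of_discrete
      (DepthOneGluing.determinedBy_exists_mem F)
  have hdecC := fun v : Fin n =>
    prodBernoulli_real_inter_eq_sum_pinW w F (A := openConn v b) (B := Rᶜ) MeasurableSet.of_discrete
      (determinedBy_forall_not_mem F)
  have hN : ∀ v : Fin n, (prodBernoulli w).real (openConn v b ∩ Rᶜ) =
      (prodBernoulli w).real (localCylinder ↑F ↑(∅ : Finset (Sym2 (Fin n)))) *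
        (prodBernoulli w₀).real (openConn v b) := by
    intro v
    rw [hdecC v]
    refine Finset.sum_eq_single_of_mem ∅ ?_ ?_
    · refine (@Finset.mem_filter _ _ (_) _ _).2 ⟨Finset.mem_powerset.2 (Finset.empty_subset F), ?_⟩
      rintro ⟨e, -, he⟩
      exact Finset.notMem_empty e (Finset.mem_coe.1 he)
    · intro J hJ hne
      exfalso
      obtain ⟨hJF, hno⟩ := (@Finset.mem_filter _ _ (_) _ _).1 hJ
      obtain ⟨e, heJ⟩ := Finset.nonempty_iff_ne_empty.2 hne
      exact hno ⟨e, Finset.mem_powerset.1 hJF heJ, Finset.mem_coe.2 heJ⟩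
  have hsplit : (prodBernoulli w).real (openConn c b ∩ R) +
      (prodBernoulli w).real (openConn c b ∩ Rᶜ) = (prodBernoulli w).real (openConn c b) :=
    measureReal_inter_add_sdiff (μ := prodBernoulli w) (s := openConn c b) hRm
  -- `μ(c↔b, R) ≤ μ(x↔b, R)` termwise
  have hcx : (prodBernoulli w).real (openConn c b ∩ R) ≤ (prodBernoulli w).real (openConn x b ∩ R) := by
    rw [hdec c, hdec x]
    refine Finset.sum_le_sum fun J hJ => mul_le_mul_of_nonneg_left ?_ measureReal_nonneg
    obtain ⟨hJF, hJR⟩ := (@Finset.mem_filter _ _ (_) _ _).1 hJ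
    exact hcore J (Finset.mem_powerset.1 hJF) hJR
  -- `μ(c↔b, Rᶜ) ≤ μ(d↔b, Rᶜ)`
  have hcd' : (prodBernoulli w).real (openConn c b ∩ Rᶜ) ≤ (prodBernoulli w).real (openConn d b ∩ Rᶜ) := by
    rw [hN c, hN d]
    exact mul_le_mul_of_nonneg_left hcd measureReal_nonneg
  rw [Set.inter_comm R (openConn x b), Set.inter_comm Rᶜ (openConn d b)]
  linarith

/-- Registered rung `stub_hybridCertificate_b` of crux stmt-CriticalPhenomena-4576 (seat b): the hybrid certificate
`μ(c ↔ b) ≤ μ(R ∩ {x ↔ b}) + μ(Rᶜ ∩ {d ↔ b})` for `c` `w⁰`-minimal among `{d} ∪ T` — `hybridCertificate`, closed statement.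
[cite: KozmaNitzan2024, Lemma 5 (p. 13), Lemma 3(i) (pp. 6–7)] -/
theorem stub_hybridCertificate_b : ∀ (n : ℕ) (w : Sym2 (Fin n) → unitInterval) (T : Finset (Fin n)) (x c d b : Fin n), x ∉ T → (∀ a ∈ T, (Literature.Probability.LatticeModels.prodBernoulli (Literature.Probability.Percolation.pinW w (↑(T.image fun a => s(x, a)) : Set (Sym2 (Fin n))) ↑(∅ : Finset (Sym2 (Fin n))))).real (Literature.Probability.Percolation.openConn c b) ≤ (Literature.Probability.LatticeModels.prodBernoulli (Literature.Probability.Percolation.pinW w (↑(T.image fun a => s(x, a)) : Set (Sym2 (Fin n))) ↑(∅ : Finset (Sym2 (Fin n))))).real (Literature.Probability.Percolation.openConn a b)) → (Literature.Probability.LatticeModels.prodBernoulli (Literature.Probability.Percolation.pinW w (↑(T.image fun a => s(x, a)) : Set (Sym2 (Fin n))) ↑(∅ : Finset (Sym2 (Fin n))))).real (Literature.Probability.Percolation.openConn c b) ≤ (Literature.Probability.LatticeModels.prodBernoulli (Literature.Probability.Percolation.pinW w (↑(T.image fun a => s(x, a)) : Set (Sym2 (Fin n))) ↑(∅ : Finset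 (Sym2 (Fin n))))).real (Literature.Probability.Percolation.openConn d b) → (Literature.Probability.LatticeModels.prodBernoulli w).real (Literature.Probability.Percolation.openConn c b) ≤ (Literature.Probability.LatticeModels.prodBernoulli w).real ({ω : Set (Sym2 (Fin n)) | ∃ a ∈ T, s(x, a) ∈ ω} ∩ Literature.Probability.Percolation.openConn x b) + (Literature.Probability.LatticeModels.prodBernoulli w).real ({ω : Set (Sym2 (Fin n)) | ∃ a ∈ T, s(x, a) ∈ ω}ᶜ ∩ Literature.Probability.Percolation.openConn d b) :=
  fun _ w T x c d b hxT hcT hcd => hybridCertificate w x c d b T hxT hcT hcd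

end HybridCertificate

end

end Summit.CriticalPhenomena.PercolationContinuityZ3.Theorems
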